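/-
Copyright (c) 2026. All rights reserved.
Released under Apache 2.0 license as described in the file LICENSE.
-/
import Summits.HodgeConjecture.HodgeConjecture.Theorems.K2LiuArchIntertwiningKTypeLadder       -- ★ (H2-alg) `rung_step` (brings ★ S2-asm `op_re_add_I_smul_im`, `cayley_re/im_mem_lie`, `evalAt_dz`)
import Summits.HodgeConjecture.HodgeConjecture.Theorems.K2LiuArchIntertwiningKFiniteSwap       -- ★ (H2-an) FILE 3 p861558 (`isArchSiegelSection_rayDeriv`, `rayDeriv_kU_eq_evalAt_op`, THE SWAP)
import Summits.HodgeConjecture.HodgeConjecture.Theorems.K2LiuArchIntertwiningSiegelLaw         -- ★ G6-arch asm FILE 1 p861609 (`isArchSiegelSection_archIntertwining`)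
import Summits.HodgeConjecture.HodgeConjecture.Theorems.K2LiuArchNormalisingScalar             -- ★ (A∞) `archScalarCoeff`, `archIntertwining_eq_archScalarCoeff_mul`
import Summits.HodgeConjecture.HodgeConjecture.Theorems.K2LiuArchIntertwiningRightEquivariance -- ★ `archIntertwining_add`, `archIntertwining_const_mul`
import Summits.HodgeConjecture.HodgeConjecture.Theorems.K2LiuArchInducedTubeSection            -- ★ (A∞-0) `isArchSiegelSection_archScalarSection`
import HarnessLib

/-!
# Crux `HLiu418`, G6-arch ASSEMBLY FILE 2: THE RUNG TRANSFER AND THE LADDER OF SECTIONS for `M_w(s)` on `U(2,2)` (`re s > ½`)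
# — `cp (M_w F_n) = (c_k(s) · ∏_{i<n} b_i ∕ a_i) • P_n` along every live arrow path, SECTION LEVEL, all binders discharged

Cell `hodgecm-mathlib`, crux item hLiu418 = `stmt-HodgeConjecture-24832` (helper lane `--supports`, count-neutral).

The four inputs of ★ (H2-alg) `rung_step` are now theorems: `hG` = ★ asm FILE 1 `isArchSiegelSection_archIntertwining` (the Siegel law of
`M_w F` for EVERY section), `hD₁∕hD₂` = ★ (H2-an) FILE 3 `integrable_and_hasDerivAt_archIntertwining_rayDeriv` (the swap `d∕dt|₀ M_w F(g e^{tX}) =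
M_w(D_X F)(g)`), `hGP` at rung 0 = ★ (A∞-R) `archIntertwining_eq_archScalarCoeff_mul` + ★ `archScalarSection_kU`, `hlin` = linearity of `M_w`
(★ `archIntertwining_add∕const_mul` + FILE 3 integrability).  This file composes them.
* §1 `isArchSiegelSection_const_mul`, `archIntertwining_inv_mul_add_I_mul`, `evalAt_add_I_mul` — bookkeeping.
* §2 **`anchor`** — RUNG 0: `f⁰_{s,k} ∈ I_w(s,χ_k)`, `cp f⁰_{s,k} = D^{−k}`, `cp (M_w f⁰_{s,k}) = c_k(s) • D^{−k}` (`re s > ½`).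
* §3 **`rung_transfer`** — ONE RUNG, fully discharged: from `(F, P, c)` with `F ∈ I_w(s,χ_k)`, `cp F = P`, `cp (M_w F) = c • P` and an arrow
  `Op^{(k,s)}_{(αβγδ)} P = a • P₁` (`a ≠ 0`), `Op^{(k,−s)}_{(αβγδ)} P = b • P₁`, the RUNG SECTION `F₁ := a⁻¹·(D_{X₁}F + i·D_{X₂}F)` (`X₁ = C·re(αβγδ)·C′`,
  `X₂ = C·im(αβγδ)·C′ ∈ 𝔲(J)`) satisfies `F₁ ∈ I_w(s,χ_k)`, `cp F₁ = P₁`, `cp (M_w F₁) = (c·b∕a) • P₁`.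
* §4 **`ladder`** — THE LADDER by induction: for block sequences `(α β γ δ)_i`, scalars `a_i ≠ 0`, `b_i` and pictures `P_0 = D^{−k}, P_1, …` with the two
  arrow identities at each `i < n`, THERE IS a section `F ∈ I_w(s,χ_k)` with `cp F = P_n` and `cp (M_w F) = (c_k(s) · ∏_{i<n} b_i∕a_i) • P_n` — the by-value
  input of ★ (H1) `differentiableOn_path_scalar` ∕ (c1) `exists_package_of_live_path` (K2Liu-p27): the `K_w`-type scalar of `M_w(s)` on the type through `P_n`
  IS `c_k(s)·∏ b_i∕a_i` on `{re s > ½}`.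
References: [LeeZhu1998, §5 p. 5032]; [Knapp1986, Ch. VII §§3–4, Ch. VIII §3]; [Shimura1997, §16.4]; [Shimura1982, (1.31)].
HONEST LABEL: HC_CM is proved only modulo the 7 printed citations (2 remaining named inputs: hLiu418 = stmt-HodgeConjecture-24832,
h413 = stmt-HodgeConjecture-24833) until rung 0 closes; count-neutral helper, closes no socket.
-/

set_option autoImplicit false
set_option linter.dupNamespace false

noncomputable section

open Complex Matrix MeasureTheory NormedSpace
open scoped ComplexConjugate ComplexOrder

namespace Summit.HodgeConjecture.HodgeConjecture.Cruxes.HLiu418.K2LiuArchLadderRungTransfer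

open Summit.HodgeConjecture.HodgeConjecture.Cruxes.HLiu418.K2LiuArchInducedTubeDefs
open Summit.HodgeConjecture.HodgeConjecture.Cruxes.HLiu418.K2LiuU22ShilovCoordinate (kU_mem_UJ)
open Summit.HodgeConjecture.HodgeConjecture.Cruxes.HLiu418.K2LiuU22CompactPictureDefs
open Summit.HodgeConjecture.HodgeConjecture.Cruxes.HLiu418.K2LiuU22CompactPictureOperatorDictionary
open Summit.HodgeConjecture.HodgeConjecture.Cruxes.HLiu418.K2LiuArchSWOnePlaceRegion (op_re_add_I_smul_im cayley_re_mem_lie cayley_im_mem_lie evalAt_dz isArchSiegelSection_add)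
open Summit.HodgeConjecture.HodgeConjecture.Cruxes.HLiu418.K2LiuArchIntertwiningKTypeLadder (rung_step)
open Summit.HodgeConjecture.HodgeConjecture.Cruxes.HLiu418.K2LiuArchIntertwiningKFiniteSwap (isArchSiegelSection_rayDeriv rayDeriv_kU_eq_evalAt_op integrable_and_hasDerivAt_archIntertwining_rayDeriv)
open Summit.HodgeConjecture.HodgeConjecture.Cruxes.HLiu418.K2LiuArchIntertwiningSiegelLaw (isArchSiegelSection_archIntertwining)
open Summit.HodgeConjecture.HodgeConjecture.Cruxes.HLiu418.K2LiuArchNormalisingScalar (archScalarCoeff archIntertwining_eq_archScalarCoeff_mul)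
open Summit.HodgeConjecture.HodgeConjecture.Cruxes.HLiu418.K2LiuArchIntertwiningRightEquivariance (archIntertwining_add archIntertwining_const_mul)
open Summit.HodgeConjecture.HodgeConjecture.Cruxes.HLiu418.K2LiuArchInducedTubeSection (isArchSiegelSection_archScalarSection)
open Summit.HodgeConjecture.HodgeConjecture.Cruxes.HLiu418.K2LiuArchKFiniteSectionMajorised (archScalarSection_kU)

/-! ## §1  Bookkeeping -/

/-- scalar multiples of Siegel sections of `I_w(s,χ)` are Siegel sections. [folklore] -/
theorem isArchSiegelSection_const_mul {χ : ℂ → ℂ} {s : ℂ} {A : Matrix (Fin 2 ⊕ Fin 2) (Fin 2 ⊕ Fin 2) ℂ → ℂ} (c : ℂ) (hA : IsArchSiegelSection χ s A) :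
    IsArchSiegelSection χ s (fun g => c * A g) := by
  intro p g hp hp21
  simp only [hA p g hp hp21]
  ring

/-- linearity of `M_w` on the rung combination: `M_w (a⁻¹·(f₁ + i f₂)) (g) = a⁻¹·(M_w f₁ (g) + i·M_w f₂ (g))` when both big-cell integrands at `g` are integrable. [folklore] -/
theorem archIntertwining_inv_mul_add_I_mul {f₁ f₂ : Matrix (Fin 2 ⊕ Fin 2) (Fin 2 ⊕ Fin 2) ℂ → ℂ} {g : Matrix (Fin 2 ⊕ Fin 2) (Fin 2 ⊕ Fin 2) ℂ} (a : ℂ)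
    (h₁ : Integrable fun r : Fin 2 → Fin 2 → ℝ => f₁ (Matrix.J (Fin 2) ℂ * fromBlocks 1 (hermOfReal r) 0 1 * g))
    (h₂ : Integrable fun r : Fin 2 → Fin 2 → ℝ => f₂ (Matrix.J (Fin 2) ℂ * fromBlocks 1 (hermOfReal r) 0 1 * g)) :
    archIntertwining (fun x => a⁻¹ * (f₁ x + I * f₂ x)) g = a⁻¹ * (archIntertwining f₁ g + I * archIntertwining f₂ g) := by
  rw [archIntertwining_const_mul, archIntertwining_add (f₂ := fun x => I * f₂ x) h₁ (h₂.const_mul I), archIntertwining_const_mul]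

/-- `ev_v x + i·ev_v y = ev_v (x + i • y)`. [folklore] -/
theorem evalAt_add_I_mul (v : Matrix (Fin 2) (Fin 2) ℂ) (hv : v.det ≠ 0) (x y : Carrier) :
    evalAt v hv x + I * evalAt v hv y = evalAt v hv (x + I • y) := by
  rw [map_add, map_smul, smul_eq_mul]

/-! ## §2  Rung 0: the anchor triple -/

/-- **RUNG 0 (the anchor)**, `re s > ½`: `f⁰_{s,k} ∈ I_w(s,χ_k)` (★ (A∞-0)), `cp f⁰_{s,k} = D^{−k}` (★ `archScalarSection_kU`), and
`cp (M_w f⁰_{s,k}) = c_k(s) • D^{−k}` (★ (A∞-R) `archIntertwining_eq_archScalarCoeff_mul` + `f⁰_{−s,k}(k_u) = det(u)^{−k}`). [Shimura1982, (1.31)] [Shimura1997, §16.4] -/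
theorem anchor (k : ℤ) {s : ℂ} (hs : 1 / 2 < s.re) :
    IsArchSiegelSection (fun z : ℂ => (conj z / ((‖z‖ : ℝ) : ℂ)) ^ k) s (archScalarSection k s : Matrix (Fin 2 ⊕ Fin 2) (Fin 2 ⊕ Fin 2) ℂ → ℂ) ∧
    (∀ (v : Matrix (Fin 2) (Fin 2) ℂ), vᴴ * v = 1 → ∀ hv : v.det ≠ 0,
      archScalarSection k s ((2 : ℂ)⁻¹ • fromBlocks (1 + v) (-(I • (1 - v))) (I • (1 - v)) (1 + v) : Matrix (Fin 2 ⊕ Fin 2) (Fin 2 ⊕ Fin 2) ℂ) = evalAt v hv (dz (-k))) ∧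
    (∀ (u : Matrix (Fin 2) (Fin 2) ℂ), uᴴ * u = 1 → ∀ hu' : u.det ≠ 0,
      archIntertwining (archScalarSection k s) ((2 : ℂ)⁻¹ • fromBlocks (1 + u) (-(I • (1 - u))) (I • (1 - u)) (1 + u) : Matrix (Fin 2 ⊕ Fin 2) (Fin 2 ⊕ Fin 2) ℂ) = evalAt u hu' (archScalarCoeff k s • dz (-k))) := by
  refine ⟨isArchSiegelSection_archScalarSection k s, fun v hv hv' => ?_, fun u hu hu' => ?_⟩
  · rw [archScalarSection_kU k s hv, evalAt_dz]
  · rw [archIntertwining_eq_archScalarCoeff_mul k hs (kU_mem_UJ hu), archScalarSection_kU k (-s) hu, map_smul, evalAt_dz, smul_eq_mul]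

/-! ## §3  The rung transfer -/

/-- **THE RUNG TRANSFER** (`re s > ½`; all binders of ★ `rung_step` discharged).  Data: `F ∈ I_w(s,χ_k)` with compact picture `P` (`F(k_v) = ev_v P`),
current scalar `c` (`M_w F (k_v) = ev_v (c • P)`), blocks `(α,β,γ,δ)`, scalars `a ≠ 0`, `b`, next picture `P₁` with the SOURCE arrow
`Op^{(k,s)}_{(αβγδ)} P = a • P₁` and the TARGET arrow `Op^{(k,−s)}_{(αβγδ)} P = b • P₁` (★ S2-T by value).  RUNG SECTION
`F₁ := y ↦ a⁻¹·(D_{X₁}F (y) + i·D_{X₂}F (y))`, `D_X F (y) = d∕dt|₀ F(y·e^{tX})`, `X₁ = C·re(αβγδ)·C′`, `X₂ = C·im(αβγδ)·C′`.  Then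
(i) `F₁ ∈ I_w(s,χ_k)`; (ii) `cp F₁ = P₁`; (iii) `cp (M_w F₁) = (c·b∕a) • P₁`.
(i): ★ `isArchSiegelSection_rayDeriv`; (ii): ★ `rayDeriv_kU_eq_evalAt_op` ×2 + ★ `op_re_add_I_smul_im` + the source arrow; (iii): ★ `rung_step` with
`G := M_w F` (`hG` ★ asm FILE 1), `D_j := M_w (D_{X_j} F)` (`hD_j` ★ (H2-an) FILE 3 at `g = k_u`), `G₁ := a⁻¹(D₁ + iD₂)`, then `M_w F₁ = G₁` at `k_u` by linearity.
[LeeZhu1998, §5 p. 5032] [Knapp1986, Ch. VIII §3] -/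
theorem rung_transfer (k : ℤ) {s : ℂ} (hs : 1 / 2 < s.re) {F : Matrix (Fin 2 ⊕ Fin 2) (Fin 2 ⊕ Fin 2) ℂ → ℂ}
    (hF : IsArchSiegelSection (fun z : ℂ => (conj z / ((‖z‖ : ℝ) : ℂ)) ^ k) s F) (P : Carrier)
    (hFP : ∀ (v : Matrix (Fin 2) (Fin 2) ℂ), vᴴ * v = 1 → ∀ hv : v.det ≠ 0, F ((2 : ℂ)⁻¹ • fromBlocks (1 + v) (-(I • (1 - v))) (I • (1 - v)) (1 + v) : Matrix (Fin 2 ⊕ Fin 2) (Fin 2 ⊕ Fin 2) ℂ) = evalAt v hv P)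
    (c : ℂ) (hMP : ∀ (v : Matrix (Fin 2) (Fin 2) ℂ), vᴴ * v = 1 → ∀ hv : v.det ≠ 0,
      archIntertwining F ((2 : ℂ)⁻¹ • fromBlocks (1 + v) (-(I • (1 - v))) (I • (1 - v)) (1 + v) : Matrix (Fin 2 ⊕ Fin 2) (Fin 2 ⊕ Fin 2) ℂ) = evalAt v hv (c • P))
    (α β γ δ : Matrix (Fin 2) (Fin 2) ℂ) (a b : ℂ) (ha : a ≠ 0) (P₁ : Carrier)
    (hsrc : (∑ a' : Fin 2, ∑ b' : Fin 2, β a' b' • pOp pd uMat dInv (s + 1 + (-(k : ℂ)) / 2) a' b' P +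
          ∑ a' : Fin 2, ∑ b' : Fin 2, γ a' b' • mOp pd uMat (s + 1 - (-(k : ℂ)) / 2) a' b' P + ((-(k : ℂ)) * (α).trace) • P -
          ∑ a' : Fin 2, ∑ b' : Fin 2, α a' b' • lOp pd uMat a' b' P + ∑ a' : Fin 2, ∑ b' : Fin 2, δ a' b' • rOp pd uMat a' b' P) = a • P₁)
    (htgt : (∑ a' : Fin 2, ∑ b' : Fin 2, β a' b' • pOp pd uMat dInv (-s + 1 + (-(k : ℂ)) / 2) a' b' P +
          ∑ a' : Fin 2, ∑ b' : Fin 2, γ a' b' • mOp pd uMat (-s + 1 - (-(k : ℂ)) / 2) a' b' P + ((-(k : ℂ)) * (α).trace) • P -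
          ∑ a' : Fin 2, ∑ b' : Fin 2, α a' b' • lOp pd uMat a' b' P + ∑ a' : Fin 2, ∑ b' : Fin 2, δ a' b' • rOp pd uMat a' b' P) = b • P₁) :
    IsArchSiegelSection (fun z : ℂ => (conj z / ((‖z‖ : ℝ) : ℂ)) ^ k) s
        (fun y : Matrix (Fin 2 ⊕ Fin 2) (Fin 2 ⊕ Fin 2) ℂ => (a)⁻¹ * (deriv (fun t : ℝ => F (y * exp (t • (fromBlocks 1 1 (I • 1) (-(I • 1)) * fromBlocks ((2 : ℂ)⁻¹ • (α - (α)ᴴ)) ((2 : ℂ)⁻¹ • (β + (γ)ᴴ)) ((2 : ℂ)⁻¹ • (γ + (β)ᴴ)) ((2 : ℂ)⁻¹ • (δ - (δ)ᴴ)) * ((2 : ℂ)⁻¹ • fromBlocks 1 (-(I • 1)) 1 (I • 1)) : Matrix (Fin 2 ⊕ Fin 2) (Fin 2 ⊕ Fin 2) ℂ)))) 0 + I * deriv (fun t : ℝ => F (y * exp (t • (fromBlocks 1 1 (I • 1) (-(I • 1)) * fromBlocks ((2 * I : ℂ)⁻¹ • (α + (α)ᴴ)) ((2 * I : ℂ)⁻¹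 • (β - (γ)ᴴ)) ((2 * I : ℂ)⁻¹ • (γ - (β)ᴴ)) ((2 * I : ℂ)⁻¹ • (δ + (δ)ᴴ)) * ((2 : ℂ)⁻¹ • fromBlocks 1 (-(I • 1)) 1 (I • 1)) : Matrix (Fin 2 ⊕ Fin 2) (Fin 2 ⊕ Fin 2) ℂ)))) 0)) ∧
      (∀ (v : Matrix (Fin 2) (Fin 2) ℂ), vᴴ * v = 1 → ∀ hv : v.det ≠ 0,
        (fun y : Matrix (Fin 2 ⊕ Fin 2) (Fin 2 ⊕ Fin 2) ℂ => (a)⁻¹ * (deriv (fun t : ℝ => F (y * exp (t • (fromBlocks 1 1 (I • 1) (-(I • 1)) * fromBlocks ((2 : ℂ)⁻¹ • (α - (α)ᴴ)) ((2 : ℂ)⁻¹ • (β + (γ)ᴴ)) ((2 : ℂ)⁻¹ • (γ + (β)ᴴ)) ((2 : ℂ)⁻¹ • (δ - (δ)ᴴ)) * ((2 : ℂ)⁻¹ • fromBlocks 1 (-(I • 1)) 1 (I • 1)) : Matrix (Fin 2 ⊕ Fin 2) (Fin 2 ⊕ Fin 2) ℂ)))) 0 + I * deriv (fun t : ℝ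 => F (y * exp (t • (fromBlocks 1 1 (I • 1) (-(I • 1)) * fromBlocks ((2 * I : ℂ)⁻¹ • (α + (α)ᴴ)) ((2 * I : ℂ)⁻¹ • (β - (γ)ᴴ)) ((2 * I : ℂ)⁻¹ • (γ - (β)ᴴ)) ((2 * I : ℂ)⁻¹ • (δ + (δ)ᴴ)) * ((2 : ℂ)⁻¹ • fromBlocks 1 (-(I • 1)) 1 (I • 1)) : Matrix (Fin 2 ⊕ Fin 2) (Fin 2 ⊕ Fin 2) ℂ)))) 0))
          ((2 : ℂ)⁻¹ • fromBlocks (1 + v) (-(I • (1 - v))) (I • (1 - v)) (1 + v) : Matrix (Fin 2 ⊕ Fin 2) (Fin 2 ⊕ Fin 2) ℂ) = evalAt v hv P₁) ∧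
      (∀ (u : Matrix (Fin 2) (Fin 2) ℂ), uᴴ * u = 1 → ∀ hu' : u.det ≠ 0,
        archIntertwining (fun y : Matrix (Fin 2 ⊕ Fin 2) (Fin 2 ⊕ Fin 2) ℂ => (a)⁻¹ * (deriv (fun t : ℝ => F (y * exp (t • (fromBlocks 1 1 (I • 1) (-(I • 1)) * fromBlocks ((2 : ℂ)⁻¹ • (α - (α)ᴴ)) ((2 : ℂ)⁻¹ • (β + (γ)ᴴ)) ((2 : ℂ)⁻¹ • (γ + (β)ᴴ)) ((2 : ℂ)⁻¹ • (δ - (δ)ᴴ)) * ((2 : ℂ)⁻¹ • fromBlocks 1 (-(I • 1)) 1 (I • 1)) : Matrix (Fin 2 ⊕ Fin 2) (Fin 2 ⊕ Fin 2) ℂ)))) 0 + I * deriv (fun t : ℝ => F (y * exp (t • (fromBlocks 1 1 (I • 1) (-(I • 1)) * fromBlocks ((2 * I : ℂ)⁻¹ • (α + (α)ᴴ)) ((2 * I : ℂ)⁻¹ • (β - (γ)ᴴ)) ((2 * I : ℂ)⁻¹ • (γ - (β)ᴴ)) ((2 * I : ℂ)⁻¹ • (δ + (δ)ᴴ)) *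 ((2 : ℂ)⁻¹ • fromBlocks 1 (-(I • 1)) 1 (I • 1)) : Matrix (Fin 2 ⊕ Fin 2) (Fin 2 ⊕ Fin 2) ℂ)))) 0))
          ((2 : ℂ)⁻¹ • fromBlocks (1 + u) (-(I • (1 - u))) (I • (1 - u)) (1 + u) : Matrix (Fin 2 ⊕ Fin 2) (Fin 2 ⊕ Fin 2) ℂ) = evalAt u hu' ((c * b / a) • P₁)) := by
  refine ⟨?_, fun v hv hv' => ?_, fun u hu hu' => ?_⟩
  · exact isArchSiegelSection_const_mul a⁻¹ (isArchSiegelSection_add (isArchSiegelSection_rayDeriv hF _)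
      (isArchSiegelSection_const_mul I (isArchSiegelSection_rayDeriv hF _)))
  · have h₁ := rayDeriv_kU_eq_evalAt_op k s hF P hFP _ _ _ _ (cayley_re_mem_lie α β γ δ) v hv hv'
    have h₂ := rayDeriv_kU_eq_evalAt_op k s hF P hFP _ _ _ _ (cayley_im_mem_lie α β γ δ) v hv hv'
    beta_reduce at h₁ h₂ ⊢
    rw [h₁, h₂, evalAt_add_I_mul, ← op_re_add_I_smul_im k s α β γ δ P, hsrc, map_smul, smul_eq_mul, ← mul_assoc, inv_mul_cancel₀ ha, one_mul]
  · have hG := isArchSiegelSection_archIntertwining k s hF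
    have hI₁ := integrable_and_hasDerivAt_archIntertwining_rayDeriv k hs hF P hFP _ _ _ _ (cayley_re_mem_lie α β γ δ) (kU_mem_UJ hu)
    have hI₂ := integrable_and_hasDerivAt_archIntertwining_rayDeriv k hs hF P hFP _ _ _ _ (cayley_im_mem_lie α β γ δ) (kU_mem_UJ hu)
    have step := rung_step k (-s) (G := fun y => archIntertwining F y)
      (D₁ := fun y => archIntertwining (fun y' : Matrix (Fin 2 ⊕ Fin 2) (Fin 2 ⊕ Fin 2) ℂ => deriv (fun t : ℝ => F (y' * exp (t • (fromBlocks 1 1 (I • 1) (-(I • 1)) * fromBlocks ((2 : ℂ)⁻¹ • (α - (α)ᴴ)) ((2 : ℂ)⁻¹ • (β + (γ)ᴴ)) ((2 : ℂ)⁻¹ • (γ + (β)ᴴ)) ((2 : ℂ)⁻¹ • (δ - (δ)ᴴ)) * ((2 : ℂ)⁻¹ • fromBlocks 1 (-(I • 1)) 1 (I • 1)) : Matrix (Fin 2 ⊕ Fin 2) (Fin 2 ⊕ Fin 2) ℂ)))) 0) y)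
      (D₂ := fun y => archIntertwining (fun y' : Matrix (Fin 2 ⊕ Fin 2) (Fin 2 ⊕ Fin 2) ℂ => deriv (fun t : ℝ => F (y' * exp (t • (fromBlocks 1 1 (I • 1) (-(I • 1)) * fromBlocks ((2 * I : ℂ)⁻¹ • (α + (α)ᴴ)) ((2 * I : ℂ)⁻¹ • (β - (γ)ᴴ)) ((2 * I : ℂ)⁻¹ • (γ - (β)ᴴ)) ((2 * I : ℂ)⁻¹ • (δ + (δ)ᴴ)) * ((2 : ℂ)⁻¹ • fromBlocks 1 (-(I • 1)) 1 (I • 1)) : Matrix (Fin 2 ⊕ Fin 2) (Fin 2 ⊕ Fin 2) ℂ)))) 0) y)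
      (G₁ := fun y => a⁻¹ * (archIntertwining (fun y' : Matrix (Fin 2 ⊕ Fin 2) (Fin 2 ⊕ Fin 2) ℂ => deriv (fun t : ℝ => F (y' * exp (t • (fromBlocks 1 1 (I • 1) (-(I • 1)) * fromBlocks ((2 : ℂ)⁻¹ • (α - (α)ᴴ)) ((2 : ℂ)⁻¹ • (β + (γ)ᴴ)) ((2 : ℂ)⁻¹ • (γ + (β)ᴴ)) ((2 : ℂ)⁻¹ • (δ - (δ)ᴴ)) * ((2 : ℂ)⁻¹ • fromBlocks 1 (-(I • 1)) 1 (I • 1)) : Matrix (Fin 2 ⊕ Fin 2) (Fin 2 ⊕ Fin 2) ℂ)))) 0) y +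
        I * archIntertwining (fun y' : Matrix (Fin 2 ⊕ Fin 2) (Fin 2 ⊕ Fin 2) ℂ => deriv (fun t : ℝ => F (y' * exp (t • (fromBlocks 1 1 (I • 1) (-(I • 1)) * fromBlocks ((2 * I : ℂ)⁻¹ • (α + (α)ᴴ)) ((2 * I : ℂ)⁻¹ • (β - (γ)ᴴ)) ((2 * I : ℂ)⁻¹ • (γ - (β)ᴴ)) ((2 * I : ℂ)⁻¹ • (δ + (δ)ᴴ)) * ((2 : ℂ)⁻¹ • fromBlocks 1 (-(I • 1)) 1 (I • 1)) : Matrix (Fin 2 ⊕ Fin 2) (Fin 2 ⊕ Fin 2) ℂ)))) 0) y))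
      hG c P P₁ hMP α β γ δ
      (fun u₀ hu₀ => (integrable_and_hasDerivAt_archIntertwining_rayDeriv k hs hF P hFP _ _ _ _ (cayley_re_mem_lie α β γ δ) (kU_mem_UJ hu₀)).2)
      (fun u₀ hu₀ => (integrable_and_hasDerivAt_archIntertwining_rayDeriv k hs hF P hFP _ _ _ _ (cayley_im_mem_lie α β γ δ) (kU_mem_UJ hu₀)).2)
      a b (fun g => by rw [← mul_assoc, mul_inv_cancel₀ ha, one_mul]) htgt hu hu'
    beta_reduce at step hI₁ hI₂ ⊢
    rw [archIntertwining_inv_mul_add_I_mul a hI₁.1 hI₂.1, map_smul, smul_eq_mul]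
    have e := congrArg (fun z => a⁻¹ * z) step
    simp only [← mul_assoc, inv_mul_cancel₀ ha, one_mul] at e
    rw [e]
    ring

/-! ## §4  The ladder -/

/-- **THE LADDER OF SECTIONS** (`re s > ½`).  Block sequences `(α β γ δ)_i`, scalars `a_i, b_i`, pictures `P_i ∈ ℂ[u, D⁻¹]` with `P_0 = D^{−k}` and, for every
`i < n`, `a_i ≠ 0`, the SOURCE arrow `Op^{(k,s)}_i P_i = a_i • P_{i+1}` and the TARGET arrow `Op^{(k,−s)}_i P_i = b_i • P_{i+1}` (★ S2-T by value, ★ (S2-C)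
live paths).  THEN there is a section `F ∈ I_w(s,χ_k)` (the `n`-th rung section of `f⁰_{s,k}`) with `cp F = P_n` and `cp (M_w(s) F) = (c_k(s) · ∏_{i<n} b_i∕a_i) • P_n`:
the `K_w`-type scalar of `M_w(s)` on the type through `P_n` is `c_k(s)·∏_{i<n} b_i∕a_i` — §2 `anchor` + `n ×` §3 `rung_transfer`.  By-value input of
★ (H1) `differentiableOn_path_scalar` ∕ (c1) `exists_package_of_live_path`. [LeeZhu1998, §5 p. 5032] [Knapp1986, Ch. VIII §3] [Shimura1982, (1.31)] -/
theorem ladder (k : ℤ) {s : ℂ} (hs : 1 / 2 < s.re) (α β γ δ : ℕ → Matrix (Fin 2) (Fin 2) ℂ) (a b : ℕ → ℂ) (P : ℕ → Carrier)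
    (hP0 : P 0 = dz (-k)) (n : ℕ) (ha : ∀ i < n, a i ≠ 0)
    (hsrc : ∀ i < n, (∑ a' : Fin 2, ∑ b' : Fin 2, β i a' b' • pOp pd uMat dInv (s + 1 + (-(k : ℂ)) / 2) a' b' (P i) +
          ∑ a' : Fin 2, ∑ b' : Fin 2, γ i a' b' • mOp pd uMat (s + 1 - (-(k : ℂ)) / 2) a' b' (P i) + ((-(k : ℂ)) * (α i).trace) • (P i) -
          ∑ a' : Fin 2, ∑ b' : Fin 2, α i a' b' • lOp pd uMat a' b' (P i) + ∑ a' : Fin 2, ∑ b' : Fin 2, δ i a' b' • rOp pd uMat a' b' (P i)) = a i • P (i + 1))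
    (htgt : ∀ i < n, (∑ a' : Fin 2, ∑ b' : Fin 2, β i a' b' • pOp pd uMat dInv (-s + 1 + (-(k : ℂ)) / 2) a' b' (P i) +
          ∑ a' : Fin 2, ∑ b' : Fin 2, γ i a' b' • mOp pd uMat (-s + 1 - (-(k : ℂ)) / 2) a' b' (P i) + ((-(k : ℂ)) * (α i).trace) • (P i) -
          ∑ a' : Fin 2, ∑ b' : Fin 2, α i a' b' • lOp pd uMat a' b' (P i) + ∑ a' : Fin 2, ∑ b' : Fin 2, δ i a' b' • rOp pd uMat a' b' (P i)) = b i • P (i + 1)) :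
    ∃ F : Matrix (Fin 2 ⊕ Fin 2) (Fin 2 ⊕ Fin 2) ℂ → ℂ, IsArchSiegelSection (fun z : ℂ => (conj z / ((‖z‖ : ℝ) : ℂ)) ^ k) s F ∧
      (∀ (v : Matrix (Fin 2) (Fin 2) ℂ), vᴴ * v = 1 → ∀ hv : v.det ≠ 0, F ((2 : ℂ)⁻¹ • fromBlocks (1 + v) (-(I • (1 - v))) (I • (1 - v)) (1 + v) : Matrix (Fin 2 ⊕ Fin 2) (Fin 2 ⊕ Fin 2) ℂ) = evalAt v hv (P n)) ∧
      (∀ (u : Matrix (Fin 2) (Fin 2) ℂ), uᴴ * u = 1 → ∀ hu' : u.det ≠ 0,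
        archIntertwining F ((2 : ℂ)⁻¹ • fromBlocks (1 + u) (-(I • (1 - u))) (I • (1 - u)) (1 + u) : Matrix (Fin 2 ⊕ Fin 2) (Fin 2 ⊕ Fin 2) ℂ) = evalAt u hu' ((archScalarCoeff k s * ∏ i ∈ Finset.range n, b i / a i) • P n)) := by
  induction n with
  | zero =>
    obtain ⟨h0, h1, h2⟩ := anchor k hs
    refine ⟨archScalarSection k s, h0, fun v hv hv' => ?_, fun u hu hu' => ?_⟩
    · rw [h1 v hv hv', hP0]
    · rw [h2 u hu hu', hP0, Finset.prod_range_zero, mul_one]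
  | succ n ih =>
    obtain ⟨F, hF, hFP, hMP⟩ := ih (fun i hi => ha i (Nat.lt_succ_of_lt hi)) (fun i hi => hsrc i (Nat.lt_succ_of_lt hi))
      (fun i hi => htgt i (Nat.lt_succ_of_lt hi))
    obtain ⟨h0, h1, h2⟩ := rung_transfer k hs hF (P n) hFP _ hMP (α n) (β n) (γ n) (δ n) (a n) (b n) (ha n (Nat.lt_succ_self n)) (P (n + 1))
      (hsrc n (Nat.lt_succ_self n)) (htgt n (Nat.lt_succ_self n))
    refine ⟨_, h0, h1, fun u hu hu' => ?_⟩
    rw [h2 u hu hu', Finset.prod_range_succ, mul_div_assoc, mul_assoc]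

end Summit.HodgeConjecture.HodgeConjecture.Cruxes.HLiu418.K2LiuArchLadderRungTransfer

end
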